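import Literature.NumberTheory.Rogawski1990.UnitOrbitalIntegralInertCountTH              -- ★ A-p03 LAYER B_H (regime lemmas, block conjugation formulas, package)
import HarnessLib

/-!
# LAYER B_H, BOUNDARY `A = b₀` (`tr δ = 3u`): Flicker's Prop. 10 at the ramified-torus literal when the corner's half-trace equals the middle eigenvalue
(Flicker (1998), Prop. 10 pp. 85–87; the case `N₊ = ∞` of «`|A − b₀| = |ϖ^{N₊}|`»)

Topic `NumberTheory/Rogawski1990`; namespace `Literature.NumberTheory.Automorphic.UnitaryGroup`.  THEOREMS ONLY (no `def`, no instance, no notation, no named fact,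
no `sorry`); kernel lane.  Cell `pub/hodgecm-mathlib`, road «N7-ns COUNT FROM FLICKER», line «N7nsCount», `stub_irredGValuePos` (κ = +1): GAP OF RECORD 07:09:11Z (B-p12)
— ★ A-p03 p841959 requires `|A − b₀| = |ϖ^{N₊}|`, impossible when `A = b₀` — REPAIR (R1) (architect A-p06 (g26) 07:09:45Z; LEAD F0P3a-plan (g9) T8-127 (2): whole
(R1) → B-p12 (g28)): the BOTTOM variant `natCard_cosets_eq_iTen_gen_of_package_of_eq` of ★ A-p03 `natCard_cosets_eq_iTen_gen_of_package` (same regime lemmas, the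
`ν = N₊` regime void, every comparison with `|A − b| = 0` trivial; value `iTen q ν N₊ m` for ANY `N₊ ≥ ν + 1`, where `iTen` is constant), and its two lifts
`natCard_cosets_ramifiedTorus_{even,odd}_eq_iTen_of_eq` to B-p12's representatives (proofs = A-p03's ★ `…CountTH` :157 ∕ :205 minus the σ-defect block).  The
`U ⧸ K` value `phiTHM q (N+1) N` then follows from ★ B-p12 `natCard_fixedPoints_unitaryInt_ramifiedTorus_eq_phiTHM_of_counts` (p842134) — sequel file.
HONEST LABEL: HC_CM is proved only modulo the printed citations (2 remaining named inputs hLiu418, h413) until rung 0 closes.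

## References
* [Flicker1998UnitaryFL] Y. Z. Flicker, *Elementary proof of the fundamental lemma for a unitary group*, Canad. J. Math. 50 (1998): Prop. 8 p. 84, Prop. 10 pp. 85–87.
* [Rogawski1990] J. D. Rogawski, *Automorphic Representations of Unitary Groups in Three Variables* (1990), §4.9 p. 55.
-/

set_option autoImplicit false

open scoped MatrixGroups WithZero Valued
open Matrix

namespace Literature.NumberTheory.Automorphic

namespace UnitaryGroup

open Literature.NumberTheory.Automorphic.HermitianLattice (unitaryInt mem_unitaryInt_iff LocalConjDatum)
open Literature.NumberTheory.Rogawski1990.Flicker1998 (iTen)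
open IsLocalRing

variable {K : Type*} [Field K] [Valued K ℤᵐ⁰] {ϖ : K} (σ : K →+* K) {J : Matrix (Fin 3) (Fin 3) K}

section Boundary

variable [IsDiscreteValuationRing 𝒪[K]] [Finite (ResidueField 𝒪[K])]

/-- **FLICKER'S PROPOSITION 10, GENERAL RATIO, BOUNDARY `A = b`** (`tr τ = 3b`): for `τ = !![A,0,B₂p; 0,b,0; B₂,0,A] ∈ H` (`|p| < 1`, `σp = p`, `|B₂| = |ϖ^ν|`)
with `A = b`, `#{y ∈ P_H ⧸ (P_H ∩ H^K_m) : y⁻¹ τ y ∈ H^K_m} = iTen q ν N₊ m` for EVERY `N₊ ≥ ν + 1` (the `ν = N₊` regime is void and every comparison with `|A − b| = 0`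
is trivial; same regime lemmas ★ `natCard_cosets_eq_index_of_le_gen` ∕ `…_zero_of_lt_gen` ∕ `…_zero_of_ne_gen` and ★ B-p04's package).  The boundary clause of ★
`natCard_cosets_eq_iTen_gen_of_package` (architect A-p06 (g26) 07:09:45Z (R1); LEAD T8-127 (2)). [cite: Flicker1998UnitaryFL, Prop. 10 pp. 85–86; Prop. 8 p. 84] -/
theorem natCard_cosets_eq_iTen_gen_of_package_of_eq (hJ : J = (StdForm.antidiagonal 3).over K) (hd : LocalConjDatum σ ϖ)
    (hσO : ∀ y : 𝒪[K], (σ.comp 𝒪[K].subtype) y ∈ 𝒪[K]) {y : K} (hy : y * σ y = -2)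
    {m ν Np : ℕ}
    {c um τ : ↥(unitaryGroupOfForm σ J)} (hc : ((c : GL (Fin 3) K) : Matrix (Fin 3) (Fin 3) K) = !![1, 0, 0; 0, -1, 0; 0, 0, 1])
    (hum : ((um : GL (Fin 3) K) : Matrix (Fin 3) (Fin 3) K) = !![ϖ ^ m, y, (ϖ ^ m)⁻¹; 0, 1, -σ y * (ϖ ^ m)⁻¹; 0, 0, (ϖ ^ m)⁻¹])
    {A B₁ B₂ b p : K} (hB₁ : B₁ = B₂ * p) (hvp : Valued.v p < 1)
    (hτ : ((τ : GL (Fin 3) K) : Matrix (Fin 3) (Fin 3) K) = !![A, 0, B₁; 0, b, 0; B₂, 0, A])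
    (hτH : τ ∈ Subgroup.centralizer ({c} : Set ↥(unitaryGroupOfForm σ J)))
    (hB₂ : Valued.v B₂ = Valued.v (ϖ ^ ν)) (hAb : A = b) (hNp : ν + 1 ≤ Np)
    {q : ℕ} (hq : Nat.card (ResidueField 𝒪[K]) = q ^ 2)
    {a₀ : 𝒪[K]} (ha₀ : IsUnit (((σ.comp 𝒪[K].subtype).codRestrict 𝒪[K] hσO) a₀ - a₀)) :
    (Nat.card {w : ↥(flickerPH σ J c) ⧸ (flickerHK σ J c um).subgroupOf (flickerPH σ J c) //
      ((Quotient.out w : ↥(flickerPH σ J c)) : ↥(unitaryGroupOfForm σ J))⁻¹ * τ * (Quotient.out w : ↥(flickerPH σ J c)) ∈ flickerHK σ J c um} : ℚ) =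
      iTen q ν Np m := by
  have hq0 : q ≠ 0 := by
    rintro rfl
    have h1 : 0 < Nat.card (ResidueField 𝒪[K]) := Nat.card_pos
    rw [hq] at h1; simp at h1
  have hϖ0 : ϖ ≠ 0 := hd.ϖ_ne_zero
  have hB₂0 : B₂ ≠ 0 := fun h => by
    rw [h, map_zero] at hB₂; exact (pow_ne_zero _ hϖ0) ((map_eq_zero _).1 hB₂.symm)
  have hvmm : Valued.v (ϖ ^ m) * Valued.v (ϖ ^ m) = Valued.v (ϖ ^ (2 * m)) := by rw [← map_mul, ← pow_add, two_mul]
  have hAb0 : Valued.v (A - b) = 0 := by rw [hAb, sub_self, map_zero]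
  haveI := finite_quotient_flickerHK σ hJ hd hy hσO m hum hc hq ha₀
  rcases Nat.eq_zero_or_pos m with hm0 | hm
  · -- `m = 0`: one coset
    subst hm0
    have hall := natCard_cosets_eq_index_of_le_gen σ hJ hd hy 0 hc hum hB₁ hvp.le hτ hτH
      (by rw [hAb0]; exact zero_le) (by rw [hB₂, hvmm, v_pow_le_v_pow_iff σ hd]; omega)
    rw [hall, index_flickerHK_subgroupOf_flickerPH_eq_one σ hJ hd hy hσO hum hc hq ha₀, iTen, if_pos rfl, Nat.cast_one]
  have hm0 : m ≠ 0 := by omega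
  by_cases hνm : ν < m
  · -- `m > ν`: empty
    rw [natCard_cosets_eq_zero_of_lt_gen σ hJ hd hy m hc hum hB₁ hvp hB₂0 hτ hτH (by rw [hB₂, v_pow_lt_v_pow_iff σ hd]; exact hνm),
      iTen, if_neg hm0, if_neg (by omega), if_neg (by omega), Nat.cast_zero]
  have hmν : m ≤ ν := by omega
  have hB₂m : Valued.v B₂ ≤ Valued.v (ϖ ^ m) := by rw [hB₂, v_pow_le_v_pow_iff σ hd]; exact hmν
  by_cases h2m : 2 * m ≤ ν
  · -- `2m ≤ ν < N₊`: the full index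
    have hall := natCard_cosets_eq_index_of_le_gen σ hJ hd hy m hc hum hB₁ hvp.le hτ hτH
      (by rw [hAb0]; exact zero_le) (by rw [hB₂, hvmm, v_pow_le_v_pow_iff σ hd]; exact h2m)
    rw [hall, index_flickerHK_subgroupOf_flickerPH_eq σ hJ hd hy hσO hm hum hc hq ha₀, cast_index_eq hq0 hm, iTen, if_neg hm0, if_pos (by omega)]
  · -- `ν < 2m`, `A = b`: no solution (`|ϖ^{2m}| < |B₂| = max(|A − b|, |B₂|)`, and `|A − b| = 0 ≠ |B₂|`)
    have hne : Valued.v (A - b) ≠ Valued.v B₂ := by rw [hAb0]; exact fun h => hB₂0 ((map_eq_zero _).1 h.symm)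
    have hbig : Valued.v (ϖ ^ m) * Valued.v (ϖ ^ m) < max (Valued.v (A - b)) (Valued.v B₂) := by
      rw [hvmm, hAb0, hB₂, max_eq_right zero_le, v_pow_lt_v_pow_iff σ hd]; omega
    rw [natCard_cosets_eq_zero_of_ne_gen σ hJ hd hy m hc hum hB₁ hvp hB₂0 hτ hτH hB₂m (Or.inr ⟨hne, hbig⟩),
      iTen, if_neg hm0, if_neg (by omega), if_neg (by omega), Nat.cast_zero]

/-- **PROP. 10, `T_H` CLAUSE, EVEN REPRESENTATIVE, BOUNDARY `A = b₀`**: as ★ `natCard_cosets_ramifiedTorus_even_eq_iTen` with `|A − b₀| = |ϖ^{N₊}|` replaced by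
`A = b₀` and ANY `N₊ ≥ N + 1` (the value `iTen q (N − 2a) N₊ m` is constant there). [cite: Flicker1998UnitaryFL, Prop. 10 p. 85, p. 87] -/
theorem natCard_cosets_ramifiedTorus_even_eq_iTen_of_eq (hJ : J = (StdForm.antidiagonal 3).over K) (hd : LocalConjDatum σ ϖ)
    (hσO : ∀ y : 𝒪[K], (σ.comp 𝒪[K].subtype) y ∈ 𝒪[K]) {y : K} (hy : y * σ y = -2)
    {c um t r : ↥(unitaryGroupOfForm σ J)} (hc : ((c : GL (Fin 3) K) : Matrix (Fin 3) (Fin 3) K) = !![1, 0, 0; 0, -1, 0; 0, 0, 1])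
    {m : ℕ} (hum : ((um : GL (Fin 3) K) : Matrix (Fin 3) (Fin 3) K) = !![ϖ ^ m, y, (ϖ ^ m)⁻¹; 0, 1, -σ y * (ϖ ^ m)⁻¹; 0, 0, (ϖ ^ m)⁻¹])
    {A B C b₀ ρ : K} (hte : ((t : GL (Fin 3) K) : Matrix (Fin 3) (Fin 3) K) = !![A, 0, B; 0, b₀, 0; C, 0, A])
    (htH : t ∈ Subgroup.centralizer ({c} : Set ↥(unitaryGroupOfForm σ J))) (hBC : B = C * ρ) (hvρ : Valued.v ρ = Valued.v ϖ)
    {a : ℕ} (hr : ((r : GL (Fin 3) K) : Matrix (Fin 3) (Fin 3) K) = !![(ϖ ^ a)⁻¹, 0, 0; 0, 1, 0; 0, 0, ϖ ^ a])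
    (hrH : r ∈ Subgroup.centralizer ({c} : Set ↥(unitaryGroupOfForm σ J)))
    {N Np : ℕ} (hvC : Valued.v C = Valued.v (ϖ ^ N)) (hAb : A = b₀) (hNp : N + 1 ≤ Np) (haN : 2 * a ≤ N)
    {q : ℕ} (hq : Nat.card (ResidueField 𝒪[K]) = q ^ 2)
    {a₀ : 𝒪[K]} (ha₀ : IsUnit (((σ.comp 𝒪[K].subtype).codRestrict 𝒪[K] hσO) a₀ - a₀)) :
    (Nat.card {w : ↥(flickerPH σ J c) ⧸ (flickerHK σ J c um).subgroupOf (flickerPH σ J c) //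
      ((Quotient.out w : ↥(flickerPH σ J c)) : ↥(unitaryGroupOfForm σ J))⁻¹ * (r⁻¹ * t * r) * (Quotient.out w : ↥(flickerPH σ J c)) ∈
        flickerHK σ J c um} : ℚ) = iTen q (N - 2 * a) Np m := by
  have hϖ0 : ϖ ≠ 0 := hd.ϖ_ne_zero
  have hpa : ϖ ^ a ≠ 0 := pow_ne_zero _ hϖ0
  have hC : C ≠ 0 := fun h => by rw [h, map_zero] at hvC; exact hpa.elim |> fun _ => (pow_ne_zero _ hϖ0) ((map_eq_zero _).1 hvC.symm)
  have hρ0 : ρ ≠ 0 := fun h => by rw [h, map_zero] at hvρ; exact hϖ0 ((map_eq_zero _).1 hvρ.symm)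
  have hτ := coe_diag_inv_mul_block_mul_diag σ hpa hte hr
  have hτH : r⁻¹ * t * r ∈ Subgroup.centralizer ({c} : Set ↥(unitaryGroupOfForm σ J)) :=
    Subgroup.mul_mem _ (Subgroup.mul_mem _ (Subgroup.inv_mem _ hrH) htH) hrH
  have hB₁ : B * ϖ ^ a * ϖ ^ a = C * (ϖ ^ a)⁻¹ * (ϖ ^ a)⁻¹ * (ρ * (ϖ ^ a * ϖ ^ a * (ϖ ^ a * ϖ ^ a))) := by
    rw [hBC]; field_simp
  have hvp : Valued.v (ρ * (ϖ ^ a * ϖ ^ a * (ϖ ^ a * ϖ ^ a))) < 1 := by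
    have e4 : ρ * (ϖ ^ a * ϖ ^ a * (ϖ ^ a * ϖ ^ a)) = ρ * ϖ ^ (4 * a) := by ring
    rw [e4, map_mul, hvρ, hd.vϖ, hd.v_pow, ← WithZero.exp_add, ← WithZero.exp_zero, WithZero.exp_lt_exp]; omega
  have hB₂ : Valued.v (C * (ϖ ^ a)⁻¹ * (ϖ ^ a)⁻¹) = Valued.v (ϖ ^ (N - 2 * a)) := by
    rw [map_mul, map_mul, map_inv₀, hvC, hd.v_pow, hd.v_pow, hd.v_pow, ← WithZero.exp_neg, ← WithZero.exp_add, ← WithZero.exp_add,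
      WithZero.exp_inj]; omega
  exact natCard_cosets_eq_iTen_gen_of_package_of_eq σ hJ hd hσO hy hc hum hB₁ hvp hτ hτH hB₂ hAb (by omega) hq ha₀

/-- **PROP. 10, `T_H` CLAUSE, ODD REPRESENTATIVE, BOUNDARY `A = b₀`**: as ★ `natCard_cosets_ramifiedTorus_odd_eq_iTen` with `A = b₀` and ANY `N₊ ≥ N + 1`.
[cite: Flicker1998UnitaryFL, Prop. 10 p. 85, p. 87] -/
theorem natCard_cosets_ramifiedTorus_odd_eq_iTen_of_eq (hJ : J = (StdForm.antidiagonal 3).over K) (hd : LocalConjDatum σ ϖ)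
    (hσO : ∀ y : 𝒪[K], (σ.comp 𝒪[K].subtype) y ∈ 𝒪[K]) {y : K} (hy : y * σ y = -2)
    {c um t r : ↥(unitaryGroupOfForm σ J)} (hc : ((c : GL (Fin 3) K) : Matrix (Fin 3) (Fin 3) K) = !![1, 0, 0; 0, -1, 0; 0, 0, 1])
    {m : ℕ} (hum : ((um : GL (Fin 3) K) : Matrix (Fin 3) (Fin 3) K) = !![ϖ ^ m, y, (ϖ ^ m)⁻¹; 0, 1, -σ y * (ϖ ^ m)⁻¹; 0, 0, (ϖ ^ m)⁻¹])
    {A B C b₀ ρ : K} (hte : ((t : GL (Fin 3) K) : Matrix (Fin 3) (Fin 3) K) = !![A, 0, B; 0, b₀, 0; C, 0, A])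
    (htH : t ∈ Subgroup.centralizer ({c} : Set ↥(unitaryGroupOfForm σ J))) (hBC : B = C * ρ) (hvρ : Valued.v ρ = Valued.v ϖ)
    {d : K} (hvd : Valued.v d = 1) {a : ℕ}
    (hr : ((r : GL (Fin 3) K) : Matrix (Fin 3) (Fin 3) K) = !![0, 0, ϖ ^ (a + 1) / d; 0, 1, 0; -d * (ϖ ^ (a + 1))⁻¹, 0, 0])
    (hrH : r ∈ Subgroup.centralizer ({c} : Set ↥(unitaryGroupOfForm σ J)))
    {N Np : ℕ} (hvC : Valued.v C = Valued.v (ϖ ^ N)) (hAb : A = b₀) (hNp : N + 1 ≤ Np) (haN : 2 * a + 1 ≤ N)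
    {q : ℕ} (hq : Nat.card (ResidueField 𝒪[K]) = q ^ 2)
    {a₀ : 𝒪[K]} (ha₀ : IsUnit (((σ.comp 𝒪[K].subtype).codRestrict 𝒪[K] hσO) a₀ - a₀)) :
    (Nat.card {w : ↥(flickerPH σ J c) ⧸ (flickerHK σ J c um).subgroupOf (flickerPH σ J c) //
      ((Quotient.out w : ↥(flickerPH σ J c)) : ↥(unitaryGroupOfForm σ J))⁻¹ * (r⁻¹ * t * r) * (Quotient.out w : ↥(flickerPH σ J c)) ∈
        flickerHK σ J c um} : ℚ) = iTen q (N - (2 * a + 1)) Np m := by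
  have hϖ0 : ϖ ≠ 0 := hd.ϖ_ne_zero
  have hpa : ϖ ^ (a + 1) ≠ 0 := pow_ne_zero _ hϖ0
  have hd0 : d ≠ 0 := fun h => by rw [h, map_zero] at hvd; exact zero_ne_one hvd
  have hC : C ≠ 0 := fun h => by rw [h, map_zero] at hvC; exact (pow_ne_zero _ hϖ0) ((map_eq_zero _).1 hvC.symm)
  have hρ0 : ρ ≠ 0 := fun h => by rw [h, map_zero] at hvρ; exact hϖ0 ((map_eq_zero _).1 hvρ.symm)
  have hB0 : B ≠ 0 := by rw [hBC]; exact mul_ne_zero hC hρ0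
  have hx : ϖ ^ (a + 1) / d ≠ 0 := div_ne_zero hpa hd0
  have hz : -d * (ϖ ^ (a + 1))⁻¹ ≠ 0 := mul_ne_zero (neg_ne_zero.2 hd0) (inv_ne_zero hpa)
  have hτ := coe_antidiag_inv_mul_block_mul_antidiag σ hx hz hte hr
  have hτH : r⁻¹ * t * r ∈ Subgroup.centralizer ({c} : Set ↥(unitaryGroupOfForm σ J)) :=
    Subgroup.mul_mem _ (Subgroup.mul_mem _ (Subgroup.inv_mem _ hrH) htH) hrH
  -- valuations of `x = ϖ^{a+1}∕d`, `z = −dϖ^{−(a+1)}`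
  have hvx : Valued.v (ϖ ^ (a + 1) / d) = Valued.v (ϖ ^ (a + 1)) := by rw [map_div₀, hvd, div_one]
  have hvz : Valued.v (-d * (ϖ ^ (a + 1))⁻¹) = (Valued.v (ϖ ^ (a + 1)))⁻¹ := by rw [map_mul, Valuation.map_neg, hvd, one_mul, map_inv₀]
  -- the ratio `p′ = x²∕(ρ z²)`
  have hB₁ : C * (ϖ ^ (a + 1) / d) / (-d * (ϖ ^ (a + 1))⁻¹) =
      B * (-d * (ϖ ^ (a + 1))⁻¹) / (ϖ ^ (a + 1) / d) *
        ((ϖ ^ (a + 1) / d) * (ϖ ^ (a + 1) / d) / (ρ * ((-d * (ϖ ^ (a + 1))⁻¹) * (-d * (ϖ ^ (a + 1))⁻¹)))) := by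
    rw [hBC]; field_simp
  have hvp : Valued.v ((ϖ ^ (a + 1) / d) * (ϖ ^ (a + 1) / d) / (ρ * ((-d * (ϖ ^ (a + 1))⁻¹) * (-d * (ϖ ^ (a + 1))⁻¹)))) < 1 := by
    rw [map_div₀, map_mul, map_mul, map_mul, hvx, hvz, hvρ, hd.v_pow, hd.vϖ, ← WithZero.exp_neg, ← WithZero.exp_add, ← WithZero.exp_add,
      ← WithZero.exp_add, ← WithZero.exp_sub, ← WithZero.exp_zero, WithZero.exp_lt_exp]; omega
  have hB₂ : Valued.v (B * (-d * (ϖ ^ (a + 1))⁻¹) / (ϖ ^ (a + 1) / d)) = Valued.v (ϖ ^ (N - (2 * a + 1))) := by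
    rw [map_div₀, map_mul, hvz, hvx, hBC, map_mul, hvC, hvρ, hd.v_pow, hd.v_pow, hd.v_pow, hd.vϖ, ← WithZero.exp_neg, ← WithZero.exp_add,
      ← WithZero.exp_add, ← WithZero.exp_sub, WithZero.exp_inj]; omega
  exact natCard_cosets_eq_iTen_gen_of_package_of_eq σ hJ hd hσO hy hc hum hB₁ hvp hτ hτH hB₂ hAb (by omega) hq ha₀

end Boundary

end UnitaryGroup

end Literature.NumberTheory.Automorphic
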